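import Summits.FinalStateConjecture.FinalStateConjecture.Theorems.PhotonSphereChannelsKerrDevDefs
import Literature.Geometry.Lorentzian.ConvergenceTransport
import HarnessLib

/-!
# Route PhotonSphereChannels · crux `ChannelsResolveTameDevelopmentsR` (K2R) — transport of anchored Kerr
# window charts and of `kerrDev` along time-orientation preserving isometric immersions
# (line `kerr-isolation-dichotomy`; supports stub S1 `stub_silentHullExtraction`, exact shadow of its dictionary)

The one-sided deviation dictionary of S1 pushes a near-optimal anchored window chart of a limit
spacetime through the comparison maps of a pointed `C²_loc` datum, whose pulled-back metrics are
only APPROXIMATELY the limit metric. This file proves the EXACT (`ε = 0`) shadow, which is also what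
S2 uses to transport `kerrDev = 0` along an isometric Kerr chart ("translate the isometric chart"):

* `isOpen_kerrWindow`, `isOpen_image_kerrWindow` — the window `B_R(x₀) ∩ {r > r₊}` is open in the
  exterior and its coordinate image is open in `E4` (so `Cᵏ` sup norms over it only see germs);
* `isWindowChart_comp` — an anchored window chart `Ψ` at `q ∈ 𝓢` composed with a smooth injective
  isometric immersion `F : 𝓢 → 𝓣` preserving the time orientations is an anchored window chart at
  `F q` (the `future` clause by the timecone lemma `PreservesTimeOrientation.isFutureDirected_mfderiv`);
* `deviationExtend_comp_eqOn`, `supCkENorm_deviationExtend_comp` — `(F ∘ Ψ)^* g_𝓣 − g_{M,a}` and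
  `Ψ^* g_𝓢 − g_{M,a}` agree on the window (pointwise chain rule for pullbacks and `F^* g_𝓣 = g_𝓢`),
  hence have the same window `Cᵏ` sup norms;
* `anchoredDev_comp_le`, `kerrDev_comp_le` — **`kerrDev 𝓣 (F q) R ≤ kerrDev 𝓢 q R`**: the anchored
  Kerr window deviation does not increase under time-orientation preserving isometric immersions which
  are injective (open sub-spacetimes, isometric copies, global isometries both ways give equality).

References: O'Neill 1983, Ch. 3 p. 58 (pullbacks), Ch. 5 p. 145 (timecones) [ONeill1983]; the `Cᵏ`
deviation norms are those of DHRT arXiv:2104.08222, §1 [arXiv210408222], as vendored in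
`KerrConvergence.lean` / `ConvergenceTransport.lean` (`Spacetime.deviation_comp`, global version).
-/

noncomputable section

-- the operator-norm instance on `E4 →L[ℝ] E4 →L[ℝ] ℝ` needs one more level of pending
-- instance problems than the default (as in `PhotonSphereChannelsKerrDevDefs.lean`)
set_option maxSynthPendingDepth 3
-- every `Summit.FinalStateConjecture.FinalStateConjecture.…` name repeats the summit = sub-problem segment (D-0017 layout)
set_option linter.dupNamespace false

open Set Filter Function TopologicalSpace Manifold Bundle
open scoped Topology Manifold ContDiff ENNReal NNReal

namespace Summit.FinalStateConjecture.FinalStateConjecture.Theorems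

open Literature.Geometry.Lorentzian
open Summit.FinalStateConjecture.FinalStateConjecture.Theorems.TameHull

/-! ### The window is open -/

/-- The Kerr window `B_R(x₀) ∩ {r > r₊}` is open in the exterior `{r > r₊}`. [folklore] -/
theorem isOpen_kerrWindow : ∀ (M a : ℝ) (x₀ : Kerr.exterior M a) (R : ℝ), IsOpen (kerrWindow M a x₀ R) :=
  fun _ _ x₀ R ↦ (Metric.isOpen_ball (x := (x₀ : E4)) (ε := R)).preimage continuous_subtype_val

/-- The coordinate image `B_R(x₀) ∩ {r > r₊} ⊆ E4` of the Kerr window is open. [folklore] -/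
theorem isOpen_image_kerrWindow : ∀ (M a : ℝ) (x₀ : Kerr.exterior M a) (R : ℝ), IsOpen (Subtype.val '' kerrWindow M a x₀ R) :=
  fun M a x₀ R ↦ (Kerr.exterior M a).isOpen.isOpenEmbedding_subtypeVal.isOpenMap _ (isOpen_kerrWindow M a x₀ R)

/-! ### Composition with time-orientation preserving isometric immersions -/

section Transport

variable {𝓢 𝓣 : Spacetime.{0} 4}

/-- Pointwise chain rule for pullbacks of the spacetime metric along `F ∘ Ψ` at a point where `Ψ`
is differentiable (`pullbackBilin_comp` is the global version). [cite: ONeill1983, Ch. 3, p. 58] -/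
theorem pullbackBilin_comp_apply_of_mdifferentiableAt {M a : ℝ} {F : 𝓢.carrier → 𝓣.carrier}
    {Ψ : Kerr.exterior M a → 𝓢.carrier} {x : Kerr.exterior M a}
    (hF : MDifferentiableAt (𝓡 4) (𝓡 4) F (Ψ x)) (hΨ : MDifferentiableAt 𝓘(ℝ, E4) (𝓡 4) Ψ x) :
    pullbackBilin (I := 𝓡 4) (I' := 𝓘(ℝ, E4)) (F ∘ Ψ) 𝓣.metric.val x =
      pullbackBilin (I := 𝓡 4) (I' := 𝓘(ℝ, E4)) Ψ
        (pullbackBilin (I := 𝓡 4) (I' := 𝓡 4) F 𝓣.metric.val) x := by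
  ext v w
  simp only [pullbackBilin_apply, Function.comp_apply]
  rw [mfderiv_comp x hF hΨ]
  rfl

/-- **Anchored window charts compose with time-orientation preserving isometric immersions.** If
`Ψ` is an anchored window chart at `q ∈ 𝓢` and `F : 𝓢 → 𝓣` is smooth, injective, isometric
(`F^* g_𝓣 = g_𝓢`) and preserves the time orientations, then `F ∘ Ψ` is an anchored window chart at
`F q` (same parameters, anchor and scale); the orientation clause is the timecone lemma.
[cite: ONeill1983, Ch. 5, p. 145] -/
theorem isWindowChart_comp : ∀ {𝓢 𝓣 : Spacetime.{0} 4} {F : 𝓢.carrier → 𝓣.carrier}, ContMDiff (𝓡 4) (𝓡 4) ∞ F → Function.Injective F → (∀ y, pullbackBilin (I := 𝓡 4) (I' := 𝓡 4) F 𝓣.metric.val y = 𝓢.metric.val y) → 𝓢.timeOrientation.PreservesTimeOrientation F 𝓣.timeOrientation → ∀ {M a R : ℝ} {x₀ : Kerr.exterior M a} {q : 𝓢.carrier} {Ψ : Kerr.exterior M a → 𝓢.carrier}, IsWindowChart 𝓢 M a x₀ R q Ψ → IsWindowChart 𝓣 M a x₀ R (F q) (F ∘ Ψ) := by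
  intro 𝓢 𝓣 F hF hinj hiso hτ M a R x₀ q Ψ hΨ
  refine ⟨?_, hF.comp_contMDiffOn hΨ.contMDiffOn, hinj.comp_injOn hΨ.injOn, fun x hx hr ↦ ?_⟩
  · show F (Ψ x₀) = F q
    rw [hΨ.anchor]
  · have hΨd : MDifferentiableAt 𝓘(ℝ, E4) (𝓡 4) Ψ x :=
      (hΨ.contMDiffOn.contMDiffAt ((isOpen_kerrWindow M a x₀ R).mem_nhds hx)).mdifferentiableAt
        (by simp)
    have hFd : MDifferentiableAt (𝓡 4) (𝓡 4) F (Ψ x) := hF.mdifferentiableAt (by simp)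
    rw [mfderiv_comp x hFd hΨd]
    exact hτ.isFutureDirected_mfderiv hiso (hΨ.future x hx hr)

/-- **The metric deviations of `F ∘ Ψ` and `Ψ` agree on the window** (extended by zero off the
exterior as in `Spacetime.deviationExtend`): `(F ∘ Ψ)^* g_𝓣 − g_{M,a} = Ψ^* g_𝓢 − g_{M,a}` at every
point of `B_R(x₀) ∩ {r > r₊}`, by the pointwise chain rule and `F^* g_𝓣 = g_𝓢`.
[cite: ONeill1983, Ch. 3, p. 58] -/
theorem deviationExtend_comp_eqOn : ∀ {𝓢 𝓣 : Spacetime.{0} 4} {F : 𝓢.carrier → 𝓣.carrier}, ContMDiff (𝓡 4) (𝓡 4) ∞ F → (∀ y, pullbackBilin (I := 𝓡 4) (I' := 𝓡 4) F 𝓣.metric.val y = 𝓢.metric.val y) → ∀ {M a R : ℝ} {x₀ : Kerr.exterior M a} {Ψ : Kerr.exterior M a → 𝓢.carrier}, ContMDiffOn 𝓘(ℝ, E4) (𝓡 4) ∞ Ψ (kerrWindow M a x₀ R) → EqOn (𝓣.deviationExtend (Kerr.background M a) (F ∘ Ψ)) (𝓢.deviationExtend (Kerr.background M a) Ψ) (Subtype.val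 '' kerrWindow M a x₀ R) := by
  intro 𝓢 𝓣 F hF hiso M a R x₀ Ψ hΨ
  rintro _ ⟨x, hx, rfl⟩
  have hΨd : MDifferentiableAt 𝓘(ℝ, E4) (𝓡 4) Ψ x :=
    (hΨ.contMDiffAt ((isOpen_kerrWindow M a x₀ R).mem_nhds hx)).mdifferentiableAt (by simp)
  have hFd : MDifferentiableAt (𝓡 4) (𝓡 4) F (Ψ x) := hF.mdifferentiableAt (by simp)
  change 𝓣.deviationExtend (Kerr.background M a) (F ∘ Ψ) (x : (Kerr.background M a).domain).1 =
    𝓢.deviationExtend (Kerr.background M a) Ψ (x : (Kerr.background M a).domain).1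
  rw [Spacetime.deviationExtend_coe, Spacetime.deviationExtend_coe]
  unfold Spacetime.deviation
  congr 1
  change pullbackBilin (I := 𝓡 4) (I' := 𝓘(ℝ, E4)) (F ∘ Ψ) 𝓣.metric.val x =
    pullbackBilin (I := 𝓡 4) (I' := 𝓘(ℝ, E4)) Ψ 𝓢.metric.val x
  rw [pullbackBilin_comp_apply_of_mdifferentiableAt hFd hΨd,
    show pullbackBilin (I := 𝓡 4) (I' := 𝓡 4) F 𝓣.metric.val = 𝓢.metric.val from funext hiso]

/-- **Equal window `Cᵏ` sup norms**: since the two deviations agree on the OPEN coordinate image of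
the window, all their iterated derivatives agree there, so their `Cᵏ` sup norms over the window
coincide. [cite: arXiv210408222, §1] -/
theorem supCkENorm_deviationExtend_comp : ∀ {𝓢 𝓣 : Spacetime.{0} 4} {F : 𝓢.carrier → 𝓣.carrier}, ContMDiff (𝓡 4) (𝓡 4) ∞ F → (∀ y, pullbackBilin (I := 𝓡 4) (I' := 𝓡 4) F 𝓣.metric.val y = 𝓢.metric.val y) → ∀ {M a R : ℝ} {x₀ : Kerr.exterior M a} {Ψ : Kerr.exterior M a → 𝓢.carrier} (k : ℕ), ContMDiffOn 𝓘(ℝ, E4) (𝓡 4) ∞ Ψ (kerrWindow M a x₀ R) → supCkENorm (Subtype.val '' kerrWindow M a x₀ R) k (𝓣.deviationExtend (Kerr.background M a) (F ∘ Ψ)) = supCkENorm (Subtype.val '' kerrWindow M a x₀ R) k (𝓢.deviationExtend (Kerr.background M a) Ψ) := by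
  intro 𝓢 𝓣 F hF hiso M a R x₀ Ψ k hΨ
  have heq := deviationExtend_comp_eqOn hF hiso (R := R) (x₀ := x₀) hΨ
  simp only [supCkENorm]
  refine iSup_congr fun m ↦ iSup_congr fun _ ↦ iSup_congr fun y ↦ iSup_congr fun hy ↦ ?_
  rw [((Filter.eventuallyEq_of_mem ((isOpen_image_kerrWindow M a x₀ R).mem_nhds hy) heq).iteratedFDeriv
    ℝ m).eq_of_nhds]

/-- **The anchored deviation at fixed parameters does not increase along `F`**: every admissible
chart `Ψ` at `q` gives the admissible chart `F ∘ Ψ` at `F q` with the same window deviation.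
[cite: arXiv210408222, §1] -/
theorem anchoredDev_comp_le : ∀ {𝓢 𝓣 : Spacetime.{0} 4} {F : 𝓢.carrier → 𝓣.carrier}, ContMDiff (𝓡 4) (𝓡 4) ∞ F → Function.Injective F → (∀ y, pullbackBilin (I := 𝓡 4) (I' := 𝓡 4) F 𝓣.metric.val y = 𝓢.metric.val y) → 𝓢.timeOrientation.PreservesTimeOrientation F 𝓣.timeOrientation → ∀ (q : 𝓢.carrier) (M a R : ℝ), anchoredDev 𝓣 (F q) M a R ≤ anchoredDev 𝓢 q M a R := by
  intro 𝓢 𝓣 F hF hinj hiso hτ q M a R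
  refine le_iInf fun x₀ ↦ le_iInf fun Ψ ↦ le_iInf fun hΨ ↦ ?_
  have h1 : anchoredDev 𝓣 (F q) M a R ≤ supCkENorm (Subtype.val '' kerrWindow M a x₀ R) 2
      (𝓣.deviationExtend (Kerr.background M a) (F ∘ Ψ)) :=
    iInf_le_of_le x₀ <| iInf_le_of_le (F ∘ Ψ) <| iInf_le _ (isWindowChart_comp hF hinj hiso hτ hΨ)
  exact h1.trans_eq (supCkENorm_deviationExtend_comp hF hiso 2 hΨ.contMDiffOn)

/-- **`kerrDev 𝓣 (F q) R ≤ kerrDev 𝓢 q R` along a smooth, injective, time-orientation preserving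
isometric immersion `F : 𝓢 → 𝓣`** — the exact (`ε = 0`) shadow of S1's deviation dictionary and the
transport step of S2 ("translate the isometric chart"): isometric open sub-spacetimes can only have
larger anchored Kerr window deviations, globally isometric spacetimes have equal ones.
[cite: arXiv210408222, §1] -/
theorem kerrDev_comp_le : ∀ {𝓢 𝓣 : Spacetime.{0} 4} {F : 𝓢.carrier → 𝓣.carrier}, ContMDiff (𝓡 4) (𝓡 4) ∞ F → Function.Injective F → (∀ y, pullbackBilin (I := 𝓡 4) (I' := 𝓡 4) F 𝓣.metric.val y = 𝓢.metric.val y) → 𝓢.timeOrientation.PreservesTimeOrientation F 𝓣.timeOrientation → ∀ (q : 𝓢.carrier) (R : ℝ), kerrDev 𝓣 (F q) R ≤ kerrDev 𝓢 q R := by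
  intro 𝓢 𝓣 F hF hinj hiso hτ q R
  exact iInf_mono fun M ↦ iInf_mono fun a ↦ iInf_mono fun _ ↦ anchoredDev_comp_le hF hinj hiso hτ q M a R

/-- **Invariance under time-oriented isometries**: if `F : 𝓢 → 𝓣` and `G : 𝓣 → 𝓢` are smooth,
injective, isometric, time-orientation preserving and `G ∘ F = id`, then
`kerrDev 𝓣 (F q) R = kerrDev 𝓢 q R` (e.g. translations of Minkowski space, the stationary and
axial isometries of a Kerr exterior). [cite: ONeill1983, Ch. 3, Def. 3.4 (p. 58)] -/
theorem kerrDev_comp_eq : ∀ {𝓢 𝓣 : Spacetime.{0} 4} {F : 𝓢.carrier → 𝓣.carrier} {G : 𝓣.carrier → 𝓢.carrier}, ContMDiff (𝓡 4) (𝓡 4) ∞ F → Function.Injective F → (∀ y, pullbackBilin (I := 𝓡 4) (I' := 𝓡 4) F 𝓣.metric.val y = 𝓢.metric.val y) → 𝓢.timeOrientation.PreservesTimeOrientation F 𝓣.timeOrientation → ContMDiff (𝓡 4) (𝓡 4) ∞ G → Function.Injective G → (∀ y, pullbackBilin (I := 𝓡 4) (I' := 𝓡 4) G 𝓢.metric.val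 y = 𝓣.metric.val y) → 𝓣.timeOrientation.PreservesTimeOrientation G 𝓢.timeOrientation → (∀ x, G (F x) = x) → ∀ (q : 𝓢.carrier) (R : ℝ), kerrDev 𝓣 (F q) R = kerrDev 𝓢 q R := by
  intro 𝓢 𝓣 F G hF hinj hiso hτ hG hinjG hisoG hτG hGF q R
  refine le_antisymm (kerrDev_comp_le hF hinj hiso hτ q R) ?_
  have h := kerrDev_comp_le hG hinjG hisoG hτG (F q) R
  rwa [hGF] at h

end Transport

end Summit.FinalStateConjecture.FinalStateConjecture.Theorems

end
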